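import Summits.KontsevichZagierPeriods.KontsevichZagierPeriods.Theorems.HurwitzMicroSectorsNormalFormPrincipleM2FiveZetaTwo

/-!
# `NormalFormPrinciple` (stmt-KontsevichZagierPeriods-3869), line `SketchIdeator1` — leaf `stub_boxRigidity`,
# dimension two off the product type (`CatalanTwoWays`, disc side): the disc-side integrability kit

The disc-side chain of KZ moves for `[(0,1)², 1/(2−x²−y²)]` passes through the "log monomials"
`M_x(1/(2a), v)` with `a = √(2−x²)` and `v ∈ {1 + 1/a, a/(a−1), (a+1)/(a−1)}`, which are integral
representations only when `(1/(2a)) log v` is absolutely integrable on `(0,1)`. For `0 < x < 1` we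
have `1 < a < 2` and `(a−1)(a+1) = (1−x)(1+x)`, so each `v ≥ 1` satisfies `v (1−x) ≤ C` for a
numerical constant `C`; hence `0 ≤ (1/(2a)) log v ≤ log (C/(1−x)) ≤ C − log (1−x)`, an integrable
dominating function because `log` is integrable at `0`. Finally `u ↦ log (1/u)/(1+u²)` is dominated
by `|log u|` and is therefore integrable on every `Ioo lo hi ⊆ (0,1)`. Pure Mathlib real analysis;
no new definitions.
References: M. Kontsevich, D. Zagier, *Periods* (2001), §1.2.
-/

noncomputable section

open MeasureTheory Set
open Literature.NumberTheory.Transcendental Literature.NumberTheory.Transcendental.KZ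
open Literature.ModelTheory.ExponentialFields (IsSemialgebraic)

namespace Summit.KontsevichZagierPeriods.HurwitzMicroSectors.NormalFormPrinciple.PiBox.M2

/-- Elementary facts about `a = √(2 - x²)` for `0 < x < 1`: `1 < a < 2` and
`(a - 1)(a + 1) = (1 - x)(1 + x)`. -/
private theorem sqrt_two_sub_sq_facts {x : ℝ} (hx0 : 0 < x) (hx1 : x < 1) :
    1 < Real.sqrt (2 - x ^ 2) ∧ Real.sqrt (2 - x ^ 2) < 2 ∧
      (Real.sqrt (2 - x ^ 2) - 1) * (Real.sqrt (2 - x ^ 2) + 1) = (1 - x) * (1 + x) := by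
  have hx2 : x ^ 2 < 1 := by nlinarith
  refine ⟨(Real.lt_sqrt zero_le_one).2 (by linarith), (Real.sqrt_lt' two_pos).2 (by nlinarith), ?_⟩
  linear_combination Real.sq_sqrt (show (0:ℝ) ≤ 2 - x ^ 2 by linarith)

/-- The pointwise domination behind the three disc-side integrands: if `x < 1`, `0 ≤ g ≤ 1`,
`1 ≤ v`, `1 ≤ C` and `v (1 - x) ≤ C`, then `‖g log v‖ ≤ C - log (1 - x)`
(as `0 ≤ log v ≤ log (C / (1 - x)) = log C - log (1 - x)` and `log C ≤ C - 1`). -/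
private theorem norm_mul_log_le_sub_log {x g v C : ℝ} (hx1 : x < 1) (hg0 : 0 ≤ g) (hg1 : g ≤ 1)
    (hv : 1 ≤ v) (hC : 1 ≤ C) (hvC : v * (1 - x) ≤ C) :
    ‖g * Real.log v‖ ≤ C - Real.log (1 - x) := by
  have h1x : 0 < 1 - x := sub_pos.2 hx1
  have hv0 : 0 < v := one_pos.trans_le hv
  have hC0 : 0 < C := one_pos.trans_le hC
  have hlogv0 : 0 ≤ Real.log v := Real.log_nonneg hv
  have hvle : v ≤ C / (1 - x) := by rwa [le_div_iff₀ h1x]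
  have hlogv : Real.log v ≤ C - Real.log (1 - x) := by
    calc Real.log v ≤ Real.log (C / (1 - x)) := Real.log_le_log hv0 hvle
      _ = Real.log C - Real.log (1 - x) := Real.log_div hC0.ne' h1x.ne'
      _ ≤ C - Real.log (1 - x) := by linarith [Real.log_le_sub_one_of_pos hC0]
  rw [Real.norm_eq_abs, abs_of_nonneg (mul_nonneg hg0 hlogv0)]
  exact (mul_le_of_le_one_left hlogv0 hg1).trans hlogv

/-- A measurable real function dominated on `(0,1)` by `C - log (1 - x)` is integrable on `(0,1)`,
because `x ↦ log (1 - x)` is integrable there. -/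
private theorem integrableOn_Ioo_of_norm_le_sub_log {f : ℝ → ℝ} (hf : Measurable f) (C : ℝ)
    (hC : ∀ x ∈ Ioo (0:ℝ) 1, ‖f x‖ ≤ C - Real.log (1 - x)) : IntegrableOn f (Ioo (0:ℝ) 1) := by
  have hlog : IntegrableOn (fun x : ℝ => Real.log (1 - x)) (Ioo (0:ℝ) 1) := by
    rw [← intervalIntegrable_iff_integrableOn_Ioo_of_le zero_le_one]
    simpa using (intervalIntegral.intervalIntegrable_log' (a := 1) (b := 0)).comp_sub_left 1
  have hF : IntegrableOn (fun x : ℝ => C - Real.log (1 - x)) (Ioo (0:ℝ) 1) :=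
    (integrableOn_const measure_Ioo_lt_top.ne).sub hlog
  refine Integrable.mono' hF hf.aestronglyMeasurable ?_
  exact (ae_restrict_iff' measurableSet_Ioo).2 (ae_of_all _ fun x hx => hC x hx)

/-- **Integrability kit (disc side)** for the `CatalanTwoWays` chain: with `a = √(2−x²)`, the
logarithmic integrands `(1/(2a)) log (1 + 1/a)`, `(1/(2a)) log (a/(a−1))` and
`(1/(2a)) log ((a+1)/(a−1))` are absolutely integrable on `(0,1)` (each is dominated by
`C − log (1−x)` for a numerical constant `C`), and `u ↦ log (1/u)/(1+u²)` is absolutely integrable on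
every `Ioo lo hi` with `0 ≤ lo`, `hi ≤ 1` (it is dominated by `|log u|` on `(0,1)`).
[cite: KontsevichZagier2001, §1.2] -/
theorem integrable_logs_disc :
    IntegrableOn (fun x : ℝ => (1 / (2 * Real.sqrt (2 - x ^ 2))) *
      Real.log (1 + 1 / Real.sqrt (2 - x ^ 2))) (Set.Ioo (0:ℝ) 1) ∧
    IntegrableOn (fun x : ℝ => (1 / (2 * Real.sqrt (2 - x ^ 2))) *
      Real.log (Real.sqrt (2 - x ^ 2) / (Real.sqrt (2 - x ^ 2) - 1))) (Set.Ioo (0:ℝ) 1) ∧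
    IntegrableOn (fun x : ℝ => (1 / (2 * Real.sqrt (2 - x ^ 2))) *
      Real.log ((Real.sqrt (2 - x ^ 2) + 1) / (Real.sqrt (2 - x ^ 2) - 1))) (Set.Ioo (0:ℝ) 1) ∧
    (∀ lo hi : ℝ, 0 ≤ lo → hi ≤ 1 →
      IntegrableOn (fun u : ℝ => (1 / (1 + u ^ 2)) * Real.log (1 / u)) (Set.Ioo lo hi)) := by
  refine ⟨?_, ?_, ?_, ?_⟩
  · refine integrableOn_Ioo_of_norm_le_sub_log (by fun_prop) 2 fun x hx => ?_
    obtain ⟨ha1, -, -⟩ := sqrt_two_sub_sq_facts hx.1 hx.2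
    have hia0 : 0 ≤ 1 / Real.sqrt (2 - x ^ 2) := by positivity
    have hia1 : 1 / Real.sqrt (2 - x ^ 2) ≤ 1 := div_le_one_of_le₀ ha1.le (by linarith)
    exact norm_mul_log_le_sub_log hx.2 (by positivity) (div_le_one_of_le₀ (by linarith) (by linarith))
      (le_add_of_nonneg_right hia0) (by norm_num) (by nlinarith [hx.1, hx.2])
  · refine integrableOn_Ioo_of_norm_le_sub_log (by fun_prop) 6 fun x hx => ?_
    obtain ⟨ha1, ha2, hE⟩ := sqrt_two_sub_sq_facts hx.1 hx.2
    have h1x : (0:ℝ) < 1 + x := by linarith [hx.1]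
    refine norm_mul_log_le_sub_log hx.2 (by positivity) (div_le_one_of_le₀ (by linarith) (by linarith))
      ((one_le_div (sub_pos.2 ha1)).2 (by linarith)) (by norm_num) ?_
    have h : Real.sqrt (2 - x ^ 2) / (Real.sqrt (2 - x ^ 2) - 1) * (1 - x) =
        Real.sqrt (2 - x ^ 2) * (Real.sqrt (2 - x ^ 2) + 1) / (1 + x) := by
      rw [div_mul_eq_mul_div, div_eq_div_iff (sub_pos.2 ha1).ne' h1x.ne']
      linear_combination (-Real.sqrt (2 - x ^ 2)) * hE
    rw [h, div_le_iff₀ h1x]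
    nlinarith [ha1, ha2, hx.1]
  · refine integrableOn_Ioo_of_norm_le_sub_log (by fun_prop) 9 fun x hx => ?_
    obtain ⟨ha1, ha2, hE⟩ := sqrt_two_sub_sq_facts hx.1 hx.2
    have h1x : (0:ℝ) < 1 + x := by linarith [hx.1]
    refine norm_mul_log_le_sub_log hx.2 (by positivity) (div_le_one_of_le₀ (by linarith) (by linarith))
      ((one_le_div (sub_pos.2 ha1)).2 (by linarith)) (by norm_num) ?_
    have h : (Real.sqrt (2 - x ^ 2) + 1) / (Real.sqrt (2 - x ^ 2) - 1) * (1 - x) =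
        (Real.sqrt (2 - x ^ 2) + 1) * (Real.sqrt (2 - x ^ 2) + 1) / (1 + x) := by
      rw [div_mul_eq_mul_div, div_eq_div_iff (sub_pos.2 ha1).ne' h1x.ne']
      linear_combination (-(Real.sqrt (2 - x ^ 2) + 1)) * hE
    rw [h, div_le_iff₀ h1x]
    nlinarith [ha1, ha2, hx.1]
  · intro lo hi hlo hhi
    have hlog : IntegrableOn (fun u : ℝ => Real.log u) (Ioo (0:ℝ) 1) := by
      rw [← intervalIntegrable_iff_integrableOn_Ioo_of_le zero_le_one]
      exact intervalIntegral.intervalIntegrable_log'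
    have hmeas : Measurable fun u : ℝ => (1 / (1 + u ^ 2)) * Real.log (1 / u) := by fun_prop
    have h01 : IntegrableOn (fun u : ℝ => (1 / (1 + u ^ 2)) * Real.log (1 / u)) (Ioo (0:ℝ) 1) := by
      refine Integrable.mono hlog hmeas.aestronglyMeasurable (ae_of_all _ fun u => ?_)
      rw [norm_mul, one_div u, Real.log_inv, norm_neg]
      refine mul_le_of_le_one_left (norm_nonneg _) ?_
      rw [Real.norm_eq_abs, abs_of_pos (by positivity)]
      exact div_le_one_of_le₀ (by nlinarith) (by positivity)
    exact h01.mono_set (Ioo_subset_Ioo hlo hhi)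

end Summit.KontsevichZagierPeriods.HurwitzMicroSectors.NormalFormPrinciple.PiBox.M2
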